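import Summits.ABC.ABC.Theorems.TwistAmplificationSharpModerateLawTwistMinimalDefs

/-!
# Crux `TwistAmplification.SharpModerateLaw` (stmt-ABC-1975): the twist-orbit inversion — existence of the decomposition

Lead `prover-line-stmt-ABC-1975-c6-0`, skeleton v5 (line `unit-plane-conic-two-torsion`, twist-orbit inversion of the
core), stub `stub_twistDecomposition : TwistDecomposition` (file `…TwistMinimalDecomposition.lean`).

Every tower-free cusp pair `x = (c₄, c₆)` with `c₄³ ≠ c₆²` and `1728 ∣ c₄³ − c₆²` is a twist `d ⋆ x' = (d²u', d³v')`
(`twistPair`) of a TWIST-MINIMAL (`IsTwistMinimal`) tower-free pair `x'` with `1728 ∣ u'³ − v'²`, by a squarefree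
`d ≥ 1` all of whose prime factors are `≥ 5` and prime to `u'³ − v'²`. Pure elementary number theory: strong induction
on `|c₄³ − c₆²|`. If `x` is twist-minimal take `d = 1`; otherwise peel off one twisting prime `p ≥ 5`
(`p² ∣ c₄`, `p³ ∣ c₆`, `p⁷ ∤ c₄³ − c₆²`): `x = p ⋆ x₁` with `|u₁³ − v₁²| = |c₄³ − c₆²| / p⁶` strictly smaller,
`p ∤ u₁³ − v₁²`, `x₁` still tower-free and `1728 ∣ u₁³ − v₁²` (`gcd(1728, p) = 1`); decompose `x₁ = d₁ ⋆ x'` by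
induction and return `d = p·d₁` (squarefree since `p ∤ d₁`, as `d₁⁶ ∣ u₁³ − v₁²`).

* `twistDecomposition_aux` — the induction, indexed by `n = |c₄³ − c₆²|`;
* `stub_twistDecomposition` — the registered stub.
-/

noncomputable section

-- the mandated summit namespace `Summit.ABC.ABC` (summit = problem) trips the duplicate-namespace linter
set_option linter.dupNamespace false

namespace Summit.ABC.ABC.Theorems.SharpModerateLaw

/-- `1728 = 2⁶·3³` is prime to every power of a prime `p ≥ 5`. -/
theorem isCoprime_1728_pow {p : ℕ} (hp : p.Prime) (h5 : 5 ≤ p) (k : ℕ) :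
    IsCoprime (1728 : ℤ) ((p : ℤ) ^ k) := by
  have h2 : Nat.Coprime 2 p := (Nat.coprime_primes Nat.prime_two hp).mpr (by omega)
  have h3 : Nat.Coprime 3 p := (Nat.coprime_primes Nat.prime_three hp).mpr (by omega)
  have hN : Nat.Coprime 1728 (p ^ k) := by
    rw [show (1728 : ℕ) = 2 ^ 6 * 3 ^ 3 by norm_num]
    exact Nat.Coprime.pow_right k (Nat.Coprime.mul_left (Nat.Coprime.pow_left 6 h2) (Nat.Coprime.pow_left 3 h3))
  exact_mod_cast Nat.isCoprime_iff_coprime.mpr hN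

/-- Tower-freeness descends along the twist action: if `d ⋆ x'` is tower-free then so is `x'`
(each coordinate of `x'` divides the corresponding coordinate of `d ⋆ x'`). -/
theorem tf_of_tf_twistPair {d : ℤ} {x' : ℤ × ℤ} (h : TF (twistPair d x')) : TF x' := by
  obtain ⟨hA, hB, hC⟩ := h
  have hu : x'.1 ∣ (twistPair d x').1 := Dvd.intro_left _ rfl
  have hv : x'.2 ∣ (twistPair d x').2 := Dvd.intro_left _ rfl
  exact ⟨fun q hq hq5 hh => hA q hq hq5 ⟨hh.1.trans hu, hh.2.trans hv⟩,
    fun hh => hB ⟨hh.1.trans hu, hh.2.trans hv⟩, fun hh => hC ⟨hh.1.trans hu, hh.2.trans hv⟩⟩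

/-- The twist action is multiplicative in the twist parameter: `(a·b) ⋆ x = a ⋆ (b ⋆ x)`. -/
theorem twistPair_mul (a b : ℤ) (x : ℤ × ℤ) : twistPair (a * b) x = twistPair a (twistPair b x) := by
  simp only [twistPair, Prod.mk.injEq]
  exact ⟨by ring, by ring⟩

/-- **The induction.** For every `n`: every tower-free pair `x` with `|x.1³ − x.2²| = n ≠ 0` and `1728 ∣ x.1³ − x.2²`
decomposes as `d ⋆ x'` with `d ≥ 1` squarefree, all prime factors of `d` at least `5` and prime to `x'.1³ − x'.2²`,
`x'` twist-minimal, tower-free, `1728 ∣ x'.1³ − x'.2²` (strong induction on `n`, peeling one twisting prime at a time). -/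
theorem twistDecomposition_aux : ∀ (n : ℕ) (x : ℤ × ℤ), (x.1 ^ 3 - x.2 ^ 2).natAbs = n →
    x.1 ^ 3 ≠ x.2 ^ 2 → (1728 : ℤ) ∣ x.1 ^ 3 - x.2 ^ 2 → TF x →
    ∃ (d : ℕ) (x' : ℤ × ℤ), 1 ≤ d ∧ Squarefree d ∧
      (∀ p : ℕ, p.Prime → p ∣ d → 5 ≤ p ∧ ¬ (p : ℤ) ∣ x'.1 ^ 3 - x'.2 ^ 2) ∧
      x = twistPair d x' ∧ IsTwistMinimal x' ∧ TF x' ∧ (1728 : ℤ) ∣ x'.1 ^ 3 - x'.2 ^ 2 := by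
  intro n
  induction n using Nat.strong_induction_on with
  | _ n ih =>
    intro x hn hne h1728 hTF
    by_cases htm : IsTwistMinimal x
    · -- twist-minimal already: `d = 1`, `x' = x`
      refine ⟨1, x, le_rfl, squarefree_one, fun p hp hp1 => absurd (Nat.dvd_one.mp hp1) hp.ne_one, ?_, htm, hTF, h1728⟩
      refine Prod.ext ?_ ?_ <;> simp [twistPair]
    · -- a twisting prime `p ≥ 5`: `p² ∣ x.1`, `p³ ∣ x.2`, `p⁷ ∤ x.1³ − x.2²`
      simp only [IsTwistMinimal] at htm
      push Not at htm
      obtain ⟨p, hp, h5, ⟨u₁, hu₁⟩, ⟨v₁, hv₁⟩, h7⟩ := htm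
      have hp' : Prime (p : ℤ) := Nat.prime_iff_prime_int.mp hp
      -- `x = p ⋆ (u₁, v₁)` and the discriminant numerator scales by `p⁶`
      have hx₁ : x = twistPair (p : ℤ) (u₁, v₁) := Prod.ext hu₁ hv₁
      have hdisc : x.1 ^ 3 - x.2 ^ 2 = (p : ℤ) ^ 6 * (u₁ ^ 3 - v₁ ^ 2) := by rw [hu₁, hv₁]; ring
      have hw_ne : u₁ ^ 3 - v₁ ^ 2 ≠ 0 := by
        intro h
        apply hne
        rw [← sub_eq_zero, hdisc, h, mul_zero]
      -- `p ∤ u₁³ − v₁²` (else `p⁷ ∣ x.1³ − x.2²`)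
      have hpw : ¬ (p : ℤ) ∣ u₁ ^ 3 - v₁ ^ 2 := by
        intro h
        apply h7
        rw [hdisc, show ((p : ℤ)) ^ 7 = (p : ℤ) ^ 6 * p by ring]
        exact mul_dvd_mul_left _ h
      -- the measure drops
      have hlt : (u₁ ^ 3 - v₁ ^ 2).natAbs < n := by
        rw [← hn, hdisc, Int.natAbs_mul, Int.natAbs_pow, Int.natAbs_natCast]
        exact lt_mul_of_one_lt_left (Int.natAbs_pos.mpr hw_ne) (Nat.one_lt_pow (by norm_num) hp.one_lt)
      -- `1728 ∣ u₁³ − v₁²` by coprimality with `p⁶`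
      have h1728₁ : (1728 : ℤ) ∣ u₁ ^ 3 - v₁ ^ 2 := by
        rw [hdisc] at h1728
        exact (isCoprime_1728_pow hp h5 6).dvd_of_dvd_mul_left h1728
      -- tower-freeness descends
      have hTF₁ : TF (u₁, v₁) := by
        rw [hx₁] at hTF
        exact tf_of_tf_twistPair hTF
      -- induction hypothesis at `(u₁, v₁)`
      obtain ⟨d₁, x', hd₁, hsf₁, hpr₁, hx', htm', hTF', h1728'⟩ :=
        ih _ hlt (u₁, v₁) rfl (sub_ne_zero.mp hw_ne) h1728₁ hTF₁
      -- `u₁³ − v₁² = d₁⁶ (x'.1³ − x'.2²)`, so `p ∤ d₁` and `p ∤ x'.1³ − x'.2²`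
      have hw_eq : u₁ ^ 3 - v₁ ^ 2 = (d₁ : ℤ) ^ 6 * (x'.1 ^ 3 - x'.2 ^ 2) := by
        have := twistPair_cube_sub_sq (d₁ : ℤ) x'
        rw [← hx'] at this
        exact this
      have hpd₁ : ¬ p ∣ d₁ := by
        intro h
        apply hpw
        rw [hw_eq]
        exact (dvd_pow (Int.natCast_dvd_natCast.mpr h) (by norm_num : (6 : ℕ) ≠ 0)).mul_right _
      have hpx' : ¬ (p : ℤ) ∣ x'.1 ^ 3 - x'.2 ^ 2 := by
        intro h
        apply hpw
        rw [hw_eq]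
        exact h.mul_left _
      -- return `d = p · d₁`
      refine ⟨p * d₁, x', Nat.mul_pos hp.pos hd₁, ?_, ?_, ?_, htm', hTF', h1728'⟩
      · rw [Nat.squarefree_mul ((Nat.Prime.coprime_iff_not_dvd hp).mpr hpd₁)]
        exact ⟨hp.prime.squarefree, hsf₁⟩
      · intro q hq hqd
        rcases (Nat.Prime.dvd_mul hq).mp hqd with h | h
        · have hqp : q = p := (Nat.prime_dvd_prime_iff_eq hq hp).mp h
          subst hqp
          exact ⟨h5, hpx'⟩
        · exact hpr₁ q hq h
      · rw [hx₁, hx', Nat.cast_mul, twistPair_mul]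

/-- **`TwistDecomposition`** (registered stub of skeleton v5, line `unit-plane-conic-two-torsion`): every tower-free
pair `x` with `x.1³ ≠ x.2²`, `1728 ∣ x.1³ − x.2²` is `d ⋆ x'` with `d ≥ 1` squarefree, every prime factor of `d` at
least `5` and prime to `x'.1³ − x'.2²`, and `x'` twist-minimal, tower-free, `1728 ∣ x'.1³ − x'.2²`. -/
theorem stub_twistDecomposition : TwistDecomposition :=
  fun x hne h1728 hTF => twistDecomposition_aux _ x rfl hne h1728 hTF

end Summit.ABC.ABC.Theorems.SharpModerateLaw

end
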